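import Summits.NavierStokesRegularity.NavierStokesRegularity.Theses.AngularGalerkinLadder
import Summits.NavierStokesRegularity.NavierStokesRegularity.Theorems.NoOverheating.Negative.LadderLimitExposed
import Literature.Barriers.NavierStokesRegularity.NearOneDssTypeIExclusion
import Literature.Analysis.FluidPDE.TypeIAncientMildClassical
import Literature.Analysis.FluidPDE.PineauVicolRSSChaeWolf

/-!
# KJ-33 — the SMALL-CONSTANT and the FINE-RATIO strata are EXCLUDED from the window sequences of
# route `AngularGalerkinLadder` (Chae–Wolf 2017 Thm 1.3 / Rem. 1.4 = barrier `NearOneDssTypeIExclusion`)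

Refuter bookkeeping turned theorem (ns-blowup refuter lineage, plain Negative lane, `--supports`
item stmt-NavierStokesRegularity-19960 `NoOverheating`; no definition, no positive route statement).

K2 `NoOverheating` posits windows `|ln c − ln c₀| < η`, a UNIFORM Type-I bound `C₀` and a
non-degenerate renormalised amplitude `δ` for the profiles of all singular rungs beyond `L₀`; the
deciding theorem builds from K1 ∧ K2 an admissible window sequence and K3 (closed, p493315) extracts
a nontrivial Type-I rotated-DSS ancient mild limit. With the limit EXPOSED
(`AngularGalerkinLadderLadderLimit.exists_ladderLimit_typeI`, strong form: `c' ∈ [cmin, cmax]`,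
`R(φ n) → R'`, KNSS-gauge class `IsTypeIAncientMild C₀ v`), the printed excluded region of the
(constant, ratio)-plane for Type-I `λ`-DSS ancient solutions — barrier
`Literature.Barriers.NavierStokesRegularity.NearOneDssTypeIExclusion` (Chae–Wolf 2017, Thm 1.3 and
Remark 1.4; Pineau–Vicol 2026, Thm 1.6), a THEOREM of the tree — transports onto the window
sequences, kernel-checked and UNCONDITIONALLY:

* `no_windowSequence_smallConstant` — there is an ABSOLUTE `ε₀ > 0` such that NO admissible window
  sequence (any rotations `Rₙ`, any factors) has Type-I constant `C₀ ≤ ε₀`: K2's uniform Type-I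
  bound cannot be small — the windows must be «hot» (Chae–Wolf Rem. 1.4 / the tree's
  `ancient_typeI_smallConstant_eq_zero`, after one pressure on the whole past for the limit,
  Fabes–Jones–Rivière + KNSS §4);
* `no_windowSequence_fineRatio` — for every `C₀` there is `c₁ = λ₁(C₀) > 1` (Chae–Wolf's
  threshold) such that NO admissible window sequence with constant `C₀`, ASYMPTOTICALLY TRIVIAL
  rotations (`Rₙ x → x`; in particular unrotated profiles `Rₙ = 1`, the plain `λ`-DSS stratum) and
  factors frequently below some `b < c₁` exists; with `cmax < c₁` as the window form: an unrotated
  K2 must let its window reach above `λ₁(C₀)`;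
* `not_cofinal_and_noOverheating_smallConstant`, `not_cofinal_and_noOverheating_unrotated_fineRatio`,
  `rungBlowupCofinal_false_of_noOverheating_smallConstant` — read on the open cruxes: K1
  `RungBlowupCofinal` (19959) ∧ K2 (19960) with `C₀ ≤ ε₀`, resp. with unrotated windows below
  `λ₁(C₀)`, is FALSE;
* `excludedRegion_windowSequences` — the union (small constant ∪ fine ratio) in one statement.

What ESCAPES (printed evasions of the barrier, recorded, not typed): COARSE ratio at large
constant = Bradshaw–Tsai's open question 5.1 (`TypeIDSSLiouvilleConjecture`, priced in KJ-17/KJ-31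
`WallPrice(AfterK3)`); genuinely ROTATED limits `R' ≠ 1` (Pineau–Vicol 2026 Thm 1.7 covers angular
speeds `|α| ≤ α₁` or `≥ α₂` only, `α ≈ 1` open; not typed here: it needs Euler's rotation theorem to
put `R'` in the `rotZ` gauge of `pvAnsatz`).

LABEL: KERNEL. WHAT THIS IS NOT: not NS — no rung solution, window or profile is constructed; the
coarse-ratio / rotated sector is untouched; no item changes verdict; the thresholds `ε₀`, `λ₁(C₀)`
are the tree's bare existentials (no numerical test at a prescribed ratio).
References: [cite: ChaeWolf2017RemovingDSS, Thm 1.3, Remark 1.4, §3 (arXiv:1610.09464 pp. 3, 8–9)];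
[cite: PineauVicol2026, Thm 1.6, Thm 1.7 (arXiv:2607.09619 pp. 6–7)];
[cite: BradshawTsai2017CPDE, Appendix §5 question 5.1]; [cite: KochNadirashviliSereginSverak2009, §4].
-/

namespace Summit.NavierStokesRegularity.AngularGalerkinLadderFineRatioWindowsExcluded

open Set Filter MeasureTheory Topology Function
open Literature.Analysis Literature.Analysis.FluidPDE
open Literature.Barriers.NavierStokesRegularity
open Summit.NavierStokesRegularity.FluidComputer
open Summit.NavierStokesRegularity.NavierStokesRegularity.Theses.AngularGalerkinLadder
open Summit.NavierStokesRegularity.AngularGalerkinLadderLadderLimit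

/-! ### §0 One pressure on the whole past for the ladder limit -/

/-- A field of the KNSS-gauge Type-I class is a classical Navier–Stokes solution (`ν = 1`, no
force) on all of `(−∞, 0)` for ONE smooth pressure: classical on the windows `(−(k+1), 0)`
(`IsTypeIAncientMild.exists_isClassicalNSSolutionOn_Ioo`, Fabes–Jones–Rivière), the window
pressures patched after normalisation at the origin
(`IsClassicalNSSolutionOn.exists_pressure_Iio_of_Ioo`). (Same ten lines as in the tree's
`TypeIAncientMildDecay.lean`.) [cite: KochNadirashviliSereginSverak2009, §4 p. 8 (arXiv:0709.3599)] -/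
theorem exists_classical_Iio {C : ℝ}
    {v : ℝ → EuclideanSpace ℝ (Fin 3) → EuclideanSpace ℝ (Fin 3)} (hv : IsTypeIAncientMild C v) :
    ∃ P : ℝ → EuclideanSpace ℝ (Fin 3) → ℝ, IsClassicalNSSolutionOn (Iio 0) 1 0 v P := by
  have hwin : ∀ k : ℕ, ∃ q : ℝ → EuclideanSpace ℝ (Fin 3) → ℝ,
      IsClassicalNSSolutionOn (Ioo (-((k : ℝ) + 1)) 0) 1 0 v q := fun k =>
    hv.exists_isClassicalNSSolutionOn_Ioo (t₀ := -((k : ℝ) + 1)) (by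
      have : (0 : ℝ) ≤ k := Nat.cast_nonneg k
      linarith)
  choose q hq using hwin
  refine IsClassicalNSSolutionOn.exists_pressure_Iio_of_Ioo (a := fun k : ℕ => -((k : ℝ) + 1)) hq
    fun s _ => ⟨⌈-s⌉₊, ?_⟩
  have h1 : -s ≤ (⌈-s⌉₊ : ℝ) := Nat.le_ceil (-s)
  show -((⌈-s⌉₊ : ℝ) + 1) < s
  linarith

/-- A window profile forces `0 < C₀` when `0 < δ`: the amplitude floor `δ ≤ ‖u(−1, x)‖` sits under
the Type-I envelope `C₀/(‖x‖ + 1)`. [folklore] -/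
theorem typeI_const_pos_of_window {L : ℕ} {C₀ cmin cmax δ ε c : ℝ}
    {R : EuclideanSpace ℝ (Fin 3) ≃ₗᵢ[ℝ] EuclideanSpace ℝ (Fin 3)}
    {u : ℝ → EuclideanSpace ℝ (Fin 3) → EuclideanSpace ℝ (Fin 3)}
    {p : ℝ → EuclideanSpace ℝ (Fin 3) → ℝ}
    {d : ℝ → EuclideanSpace ℝ (Fin 3) → EuclideanSpace ℝ (Fin 3)} (hδ : 0 < δ)
    (hW : AngularLadder.IsWindowProfile L C₀ cmin cmax δ ε c R u p d) : 0 < C₀ := by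
  obtain ⟨x, hx⟩ := hW.2.2.2.1
  have hTI := hW.1.hasTypeIDecay (-1) (by norm_num) x
  have hden : 0 < ‖x‖ + Real.sqrt (-(-1 : ℝ)) := by
    have : 0 < Real.sqrt (-(-1 : ℝ)) := Real.sqrt_pos.2 (by norm_num)
    positivity
  by_contra hC
  have h0 : C₀ / (‖x‖ + Real.sqrt (-(-1 : ℝ))) ≤ 0 :=
    div_nonpos_of_nonpos_of_nonneg (not_lt.1 hC) hden.le
  linarith

/-! ### §1 The small-constant stratum -/

/-- **No admissible window sequence at small Type-I constant** (Chae–Wolf 2017, Remark 1.4, in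
the tree's mild/Oseen-kernel form `ancient_typeI_smallConstant_eq_zero`): there is an ABSOLUTE
`ε₀ > 0` such that constants `1 < cmin`, `0 < δ`, defect sizes `εₙ → 0`, a window rung profile at
every index — with ANY rotations and factors — and a uniform Type-I constant `C₀ ≤ ε₀` are
contradictory: the ladder limit is a classical Type-I ancient solution with constant `≤ ε₀`, hence
zero, against its non-triviality. [cite: ChaeWolf2017RemovingDSS, Remark 1.4 (arXiv:1610.09464 p. 3)] -/
theorem no_windowSequence_smallConstant :
    ∃ ε₀ : ℝ, 0 < ε₀ ∧ ∀ {C₀ cmin cmax δ : ℝ} {L : ℕ → ℕ} {ε c : ℕ → ℝ}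
      {R : ℕ → (EuclideanSpace ℝ (Fin 3) ≃ₗᵢ[ℝ] EuclideanSpace ℝ (Fin 3))}
      {u : ℕ → ℝ → EuclideanSpace ℝ (Fin 3) → EuclideanSpace ℝ (Fin 3)}
      {p : ℕ → ℝ → EuclideanSpace ℝ (Fin 3) → ℝ}
      {d : ℕ → ℝ → EuclideanSpace ℝ (Fin 3) → EuclideanSpace ℝ (Fin 3)},
      C₀ ≤ ε₀ → 1 < cmin → 0 < δ → Tendsto ε atTop (𝓝 0) →
      (∀ n, AngularLadder.IsWindowProfile (L n) C₀ cmin cmax δ (ε n) (c n) (R n) (u n) (p n)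
        (d n)) → False := by
  obtain ⟨ε₀, hε₀, H⟩ := ancient_typeI_smallConstant_eq_zero
  refine ⟨ε₀, hε₀, fun {C₀ cmin cmax δ L ε c R u p d} hC hcmin hδ hε hW => ?_⟩
  obtain ⟨φ, c', R', v, -, -, -, -, -, -, -, -, hTAM, -, -, hTI, -, hnz⟩ :=
    exists_ladderLimit_typeI hcmin hδ hε hW
  obtain ⟨P, hP⟩ := exists_classical_Iio hTAM
  have hz : ∀ t < 0, ∀ x, v t x = 0 := H hTAM.nonneg hC hP hTI
  exact hnz fun t ht => Eventually.of_forall (hz t ht)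

/-- **K1 ∧ K2 at small constant is FALSE.** With the absolute `ε₀` of
`no_windowSequence_smallConstant`: `RungBlowupCofinal` together with a `NoOverheating` whose uniform
Type-I constant is `C₀ ≤ ε₀` is contradictory (the window sequence the deciding theorem `closes`
would build — rungs `Lₙ ≥ n`, defect sizes `ε(Lₙ) → 0` — is excluded). K2's constant must exceed an
absolute threshold: the singular rungs' profiles must be uniformly «hot».
[cite: ChaeWolf2017RemovingDSS, Remark 1.4 (arXiv:1610.09464 p. 3)] -/
theorem not_cofinal_and_noOverheating_smallConstant :
    ∃ ε₀ : ℝ, 0 < ε₀ ∧ ¬ (RungBlowupCofinal ∧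
      ∃ (C₀ cmin cmax δ : ℝ) (L₀ : ℕ) (ε : ℕ → ℝ), C₀ ≤ ε₀ ∧ 1 < cmin ∧ 0 < δ ∧
        Tendsto ε atTop (𝓝 0) ∧
        ∀ L ≥ L₀, AngularLadder.RungIsSingular L →
          ∃ (c : ℝ) (R : EuclideanSpace ℝ (Fin 3) ≃ₗᵢ[ℝ] EuclideanSpace ℝ (Fin 3))
            (u : ℝ → EuclideanSpace ℝ (Fin 3) → EuclideanSpace ℝ (Fin 3))
            (p : ℝ → EuclideanSpace ℝ (Fin 3) → ℝ)
            (d : ℝ → EuclideanSpace ℝ (Fin 3) → EuclideanSpace ℝ (Fin 3)),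
            AngularLadder.IsWindowProfile L C₀ cmin cmax δ (ε L) c R u p d) := by
  obtain ⟨ε₀, hε₀, H⟩ := no_windowSequence_smallConstant
  refine ⟨ε₀, hε₀, ?_⟩
  rintro ⟨h₁, C₀, cmin, cmax, δ, L₀, ε, hC, hcmin, hδ, hε, hwin⟩
  choose L hLge hLsing using fun n : ℕ => h₁ (max L₀ n)
  choose c R u p d hW using fun n : ℕ =>
    hwin (L n) (le_trans (le_max_left _ _) (hLge n)) (hLsing n)
  have hε' : Tendsto (fun n : ℕ => ε (L n)) atTop (𝓝 0) :=
    hε.comp (tendsto_atTop_mono (fun n => le_trans (le_max_right _ _) (hLge n)) tendsto_id)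
  exact H hC hcmin hδ hε' hW

/-- Negative edge on K1 for the census: a `NoOverheating` met with uniform Type-I constant below
the absolute threshold refutes `RungBlowupCofinal`. [cite: ChaeWolf2017RemovingDSS, Remark 1.4] -/
theorem rungBlowupCofinal_false_of_noOverheating_smallConstant :
    ∃ ε₀ : ℝ, 0 < ε₀ ∧ ∀ {C₀ cmin cmax δ : ℝ} {L₀ : ℕ} {ε : ℕ → ℝ}, C₀ ≤ ε₀ → 1 < cmin → 0 < δ →
      Tendsto ε atTop (𝓝 0) →
      (∀ L ≥ L₀, AngularLadder.RungIsSingular L →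
        ∃ (c : ℝ) (R : EuclideanSpace ℝ (Fin 3) ≃ₗᵢ[ℝ] EuclideanSpace ℝ (Fin 3))
          (u : ℝ → EuclideanSpace ℝ (Fin 3) → EuclideanSpace ℝ (Fin 3))
          (p : ℝ → EuclideanSpace ℝ (Fin 3) → ℝ)
          (d : ℝ → EuclideanSpace ℝ (Fin 3) → EuclideanSpace ℝ (Fin 3)),
          AngularLadder.IsWindowProfile L C₀ cmin cmax δ (ε L) c R u p d) →
      ¬ RungBlowupCofinal := by
  obtain ⟨ε₀, hε₀, H⟩ := not_cofinal_and_noOverheating_smallConstant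
  exact ⟨ε₀, hε₀, fun {C₀ cmin cmax δ L₀ ε} hC hcmin hδ hε hwin h₁ =>
    H ⟨h₁, C₀, cmin, cmax, δ, L₀, ε, hC, hcmin, hδ, hε, hwin⟩⟩

/-! ### §2 The fine-ratio stratum (asymptotically unrotated windows) -/

/-- **No asymptotically-unrotated admissible window sequence below Chae–Wolf's threshold.** For
every `C₀` there is `c₁ = λ₁(C₀) > 1` such that constants `1 < cmin`, `0 < δ`, `εₙ → 0`, a window
rung profile with constant `C₀` and window `[cmin, cmax]`, `cmax < c₁`, at every index, and
rotations with `Rₙ x → x` for every `x`, are contradictory: the ladder limit is an UNROTATED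
(`R' = 1`) nontrivial Type-I `c'`-DSS classical ancient solution with `1 < c' ≤ cmax < c₁`, which
Chae–Wolf 2017 Thm 1.3 (`chaeWolf2017_removing_dss_holds`) removes. (`C₀ ≤ 0` is vacuous by the
amplitude floor.) [cite: ChaeWolf2017RemovingDSS, Theorem 1.3 (arXiv:1610.09464 p. 3)] -/
theorem no_windowSequence_fineRatio (C₀ : ℝ) :
    ∃ c₁ : ℝ, 1 < c₁ ∧ ∀ {cmin cmax δ : ℝ} {L : ℕ → ℕ} {ε c : ℕ → ℝ}
      {R : ℕ → (EuclideanSpace ℝ (Fin 3) ≃ₗᵢ[ℝ] EuclideanSpace ℝ (Fin 3))}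
      {u : ℕ → ℝ → EuclideanSpace ℝ (Fin 3) → EuclideanSpace ℝ (Fin 3)}
      {p : ℕ → ℝ → EuclideanSpace ℝ (Fin 3) → ℝ}
      {d : ℕ → ℝ → EuclideanSpace ℝ (Fin 3) → EuclideanSpace ℝ (Fin 3)},
      cmax < c₁ → 1 < cmin → 0 < δ → Tendsto ε atTop (𝓝 0) →
      (∀ n, AngularLadder.IsWindowProfile (L n) C₀ cmin cmax δ (ε n) (c n) (R n) (u n) (p n)
        (d n)) →
      (∀ x, Tendsto (fun n => R n x) atTop (𝓝 x)) → False := by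
  by_cases hC₀ : 0 < C₀
  · obtain ⟨c₁, hc₁, H⟩ := chaeWolf2017_removing_dss_holds C₀ hC₀
    refine ⟨c₁, hc₁, fun {cmin cmax δ L ε c R u p d} hcmax hcmin hδ hε hW hR => ?_⟩
    obtain ⟨φ, c', R', v, hφ, hc'mem, -, hRlim, -, -, -, hc', hTAM, -, hDSS, hTI, -, hnz⟩ :=
      exists_ladderLimit_typeI hcmin hδ hε hW
    obtain ⟨P, hP⟩ := exists_classical_Iio hTAM
    -- the limit rotation is trivial
    have hR' : R' = LinearIsometryEquiv.refl ℝ (EuclideanSpace ℝ (Fin 3)) :=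
      LinearIsometryEquiv.ext fun x =>
        tendsto_nhds_unique (hRlim x) ((hR x).comp hφ.tendsto_atTop)
    have hdss : IsDiscretelySelfSimilar c' v := by
      rw [← isRotatedDSS_refl_iff, ← hR']
      exact hDSS
    have hz : ∀ t < 0, ∀ x, v t x = 0 :=
      H c' hc' (lt_of_le_of_lt hc'mem.2 hcmax) v P hP hdss hTI
    exact hnz fun t ht => Eventually.of_forall (hz t ht)
  · refine ⟨2, one_lt_two, fun {cmin cmax δ L ε c R u p d} _ _ hδ _ hW _ => ?_⟩
    exact hC₀ (typeI_const_pos_of_window hδ (hW 0))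

/-- **Frequently-fine factors suffice**: with `c₁ = λ₁(C₀)` as above, an asymptotically-unrotated
admissible window sequence whose factors satisfy `cₙ ≤ b` for infinitely many `n`, for some
`b < c₁`, is contradictory (pass to that sub-window-sequence, window `[cmin, b]`).
[cite: ChaeWolf2017RemovingDSS, Theorem 1.3 (arXiv:1610.09464 p. 3)] -/
theorem no_windowSequence_frequently_fineRatio (C₀ : ℝ) :
    ∃ c₁ : ℝ, 1 < c₁ ∧ ∀ {cmin cmax δ b : ℝ} {L : ℕ → ℕ} {ε c : ℕ → ℝ}
      {R : ℕ → (EuclideanSpace ℝ (Fin 3) ≃ₗᵢ[ℝ] EuclideanSpace ℝ (Fin 3))}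
      {u : ℕ → ℝ → EuclideanSpace ℝ (Fin 3) → EuclideanSpace ℝ (Fin 3)}
      {p : ℕ → ℝ → EuclideanSpace ℝ (Fin 3) → ℝ}
      {d : ℕ → ℝ → EuclideanSpace ℝ (Fin 3) → EuclideanSpace ℝ (Fin 3)},
      b < c₁ → (∃ᶠ n in atTop, c n ≤ b) → 1 < cmin → 0 < δ → Tendsto ε atTop (𝓝 0) →
      (∀ n, AngularLadder.IsWindowProfile (L n) C₀ cmin cmax δ (ε n) (c n) (R n) (u n) (p n)
        (d n)) →
      (∀ x, Tendsto (fun n => R n x) atTop (𝓝 x)) → False := by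
  obtain ⟨c₁, hc₁, H⟩ := no_windowSequence_fineRatio C₀
  refine ⟨c₁, hc₁, fun {cmin cmax δ b L ε c R u p d} hb hfr hcmin hδ hε hW hR => ?_⟩
  obtain ⟨ψ, hψ, hle⟩ := extraction_of_frequently_atTop hfr
  exact H (cmax := b) (L := L ∘ ψ) (ε := ε ∘ ψ) (c := c ∘ ψ) (R := R ∘ ψ) (u := u ∘ ψ)
    (p := p ∘ ψ) (d := d ∘ ψ) hb hcmin hδ (hε.comp hψ.tendsto_atTop)
    (fun n => ⟨(hW (ψ n)).1, (hW (ψ n)).2.1, hle n, (hW (ψ n)).2.2.2.1, (hW (ψ n)).2.2.2.2⟩)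
    fun x => (hR x).comp hψ.tendsto_atTop

/-- **Unrotated windows** (`Rₙ = 1`, the plain `λ`-DSS stratum): no admissible window sequence with
constant `C₀` and `cmax < λ₁(C₀)`. [cite: ChaeWolf2017RemovingDSS, Theorem 1.3 (arXiv:1610.09464 p. 3)] -/
theorem no_unrotated_windowSequence_fineRatio (C₀ : ℝ) :
    ∃ c₁ : ℝ, 1 < c₁ ∧ ¬ ∃ (cmin cmax δ : ℝ) (L : ℕ → ℕ) (ε c : ℕ → ℝ)
        (u : ℕ → ℝ → EuclideanSpace ℝ (Fin 3) → EuclideanSpace ℝ (Fin 3))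
        (p : ℕ → ℝ → EuclideanSpace ℝ (Fin 3) → ℝ)
        (d : ℕ → ℝ → EuclideanSpace ℝ (Fin 3) → EuclideanSpace ℝ (Fin 3)),
        cmax < c₁ ∧ 1 < cmin ∧ 0 < δ ∧ Tendsto ε atTop (𝓝 0) ∧
          ∀ n, AngularLadder.IsWindowProfile (L n) C₀ cmin cmax δ (ε n) (c n)
            (LinearIsometryEquiv.refl ℝ _) (u n) (p n) (d n) := by
  obtain ⟨c₁, hc₁, H⟩ := no_windowSequence_fineRatio C₀
  refine ⟨c₁, hc₁, ?_⟩
  rintro ⟨cmin, cmax, δ, L, ε, c, u, p, d, hcmax, hcmin, hδ, hε, hW⟩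
  exact H (R := fun _ => LinearIsometryEquiv.refl ℝ _) hcmax hcmin hδ hε hW
    fun x => tendsto_const_nhds

/-- **K1 ∧ (unrotated K2 below the Chae–Wolf threshold) is FALSE.** For every `C₀` there is
`c₁ = λ₁(C₀) > 1` such that `RungBlowupCofinal` together with a `NoOverheating` with constant `C₀`,
UNROTATED window profiles (`R = 1`) and window top `cmax < c₁` is contradictory. An unrotated K2
must let its window reach above `λ₁(C₀)`: «fine-ratio» profiles cannot fill the windows cofinally.
[cite: ChaeWolf2017RemovingDSS, Theorem 1.3 (arXiv:1610.09464 p. 3)] -/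
theorem not_cofinal_and_noOverheating_unrotated_fineRatio (C₀ : ℝ) :
    ∃ c₁ : ℝ, 1 < c₁ ∧ ¬ (RungBlowupCofinal ∧
      ∃ (cmin cmax δ : ℝ) (L₀ : ℕ) (ε : ℕ → ℝ), cmax < c₁ ∧ 1 < cmin ∧ 0 < δ ∧
        Tendsto ε atTop (𝓝 0) ∧
        ∀ L ≥ L₀, AngularLadder.RungIsSingular L →
          ∃ (c : ℝ) (u : ℝ → EuclideanSpace ℝ (Fin 3) → EuclideanSpace ℝ (Fin 3))
            (p : ℝ → EuclideanSpace ℝ (Fin 3) → ℝ)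
            (d : ℝ → EuclideanSpace ℝ (Fin 3) → EuclideanSpace ℝ (Fin 3)),
            AngularLadder.IsWindowProfile L C₀ cmin cmax δ (ε L) c (LinearIsometryEquiv.refl ℝ _)
              u p d) := by
  obtain ⟨c₁, hc₁, H⟩ := no_unrotated_windowSequence_fineRatio C₀
  refine ⟨c₁, hc₁, ?_⟩
  rintro ⟨h₁, cmin, cmax, δ, L₀, ε, hcmax, hcmin, hδ, hε, hwin⟩
  choose L hLge hLsing using fun n : ℕ => h₁ (max L₀ n)
  choose c u p d hW using fun n : ℕ =>
    hwin (L n) (le_trans (le_max_left _ _) (hLge n)) (hLsing n)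
  have hε' : Tendsto (fun n : ℕ => ε (L n)) atTop (𝓝 0) :=
    hε.comp (tendsto_atTop_mono (fun n => le_trans (le_max_right _ _) (hLge n)) tendsto_id)
  exact H ⟨cmin, cmax, δ, L, fun n => ε (L n), c, u, p, d, hcmax, hcmin, hδ, hε', hW⟩

/-! ### §3 The excluded region of the (constant, ratio) plane, on window sequences -/

/-- **The excluded region, transported.** There is an absolute `ε₀ > 0`, and for every `C₀` a
`c₁ = λ₁(C₀) > 1`, such that an asymptotically-unrotated admissible window sequence with constant
`C₀` and window top `cmax` is impossible whenever `C₀ ≤ ε₀` OR `cmax < c₁` — Chae–Wolf's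
small-constant strip ∪ fine-ratio region (barrier `NearOneDssTypeIExclusion`,
`eq_zero_of_smallConstant_or_fineRatio`). What lies outside — coarse ratio at large constant, or a
genuinely rotated limit — is Bradshaw–Tsai's question 5.1 / Pineau–Vicol's `α ≈ 1` gap.
[cite: ChaeWolf2017RemovingDSS, Theorem 1.3 and Remark 1.4 (arXiv:1610.09464 p. 3)] -/
theorem excludedRegion_windowSequences :
    ∃ ε₀ : ℝ, 0 < ε₀ ∧ ∀ C₀ : ℝ, ∃ c₁ : ℝ, 1 < c₁ ∧ ∀ {cmin cmax δ : ℝ} {L : ℕ → ℕ} {ε c : ℕ → ℝ}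
      {R : ℕ → (EuclideanSpace ℝ (Fin 3) ≃ₗᵢ[ℝ] EuclideanSpace ℝ (Fin 3))}
      {u : ℕ → ℝ → EuclideanSpace ℝ (Fin 3) → EuclideanSpace ℝ (Fin 3)}
      {p : ℕ → ℝ → EuclideanSpace ℝ (Fin 3) → ℝ}
      {d : ℕ → ℝ → EuclideanSpace ℝ (Fin 3) → EuclideanSpace ℝ (Fin 3)},
      (C₀ ≤ ε₀ ∨ cmax < c₁) → 1 < cmin → 0 < δ → Tendsto ε atTop (𝓝 0) →
      (∀ n, AngularLadder.IsWindowProfile (L n) C₀ cmin cmax δ (ε n) (c n) (R n) (u n) (p n)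
        (d n)) →
      (∀ x, Tendsto (fun n => R n x) atTop (𝓝 x)) → False := by
  obtain ⟨ε₀, hε₀, Hs⟩ := no_windowSequence_smallConstant
  refine ⟨ε₀, hε₀, fun C₀ => ?_⟩
  obtain ⟨c₁, hc₁, Hf⟩ := no_windowSequence_fineRatio C₀
  refine ⟨c₁, hc₁, fun {cmin cmax δ L ε c R u p d} hor hcmin hδ hε hW hR => ?_⟩
  rcases hor with hC | hcmax
  · exact Hs hC hcmin hδ hε hW
  · exact Hf hcmax hcmin hδ hε hW hR

end Summit.NavierStokesRegularity.AngularGalerkinLadderFineRatioWindowsExcluded
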